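import Literature.Analysis.FluidPDE.TaoCascadeReducedClaimAssembly
import Literature.Analysis.FluidPDE.TaoCascadeZeroScaleCritical
import HarnessLib

/-!
# Tao's cascade ODE, §6.7: the parameter regime `ZeroScale.Regime` holds in the regime of Prop. 6.5

T. Tao, *Finite time blowup for an averaged three-dimensional Navier–Stokes equation*,
J. Amer. Math. Soc. 29 (2016), 601–674 = arXiv:1402.0290v3, §6.1 (the hierarchy
`1 ≪ 1/ε₀ ≪ K ≪ 1/ε ≪ n₀`), §6.6 Prop. 6.15, §6.7.

The §6.7 development (`TaoCascadeZeroScaleCritical.lean` and its continuations) works inside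
`ZeroScale.Setting = ZeroScale.Context + ZeroScale.Regime`, where `Regime` is the explicit parameter
regime `K ≥ 10⁶`, `K ε₀ ≥ 10⁶`, `C₄ ≤ K`, `ε e^{10⁶ K¹⁰} ≤ 1`,
`(C₁ + C₂ + C₅ + 1)(1+ε₀)^{-n₀/4} ≤ ε⁴ e^{-10 K¹⁰}`. This file shows that a Prop. 6.15 proved in that
packaging discharges the regime input `ReducedClaimIIInput` of `TaoCascadeReducedClaimAssembly.lean`:
`reducedClaimIIInput_of_setting` takes as hypothesis any theorem of the shape
"`Setting … T → ZeroScale.ExitTrichotomy … T → ∃ τ₁ ∈ [1/100, T], ZeroScale.NextState … τ₁`" and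
builds, for a datum in the regime of Prop. 6.5 (`InRegime`, corrected coefficient), the `Setting` at
the time `T` from `GoodAt` on `[0, T]`, the absorbed bounds of Prop. 6.13 (whence
`ZeroScale.SmallModes K ε 11`), Lemma 6.9 (`RescaledHypotheses.zeroScale_context`, with
`C₅ = C₂(1+ε₀)²(cumEnergyConst ε₀ C₃ + 100)`), and the five `Regime` inequalities, each verified to hold
for `K` large (depending on `ε₀`), `ε` small (depending on `K`), `n₀` large (depending on
`ε₀, K, ε, C₁, C₂, C₃`) by `InRegime.of_K / of_eps / of_n0`. Consequently
(`rescaledStepCorrected'_of_setting`) the corrected Prop. 6.5 follows from such a Prop. 6.15 and the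
regime form of Prop. 6.13 (`SmallScaleOneInput`). Theorems only.

## References

* T. Tao, J. Amer. Math. Soc. 29 (2016), 601–674 = arXiv:1402.0290v3, §6.1, §6.6 Prop. 6.15, §6.7.
  [`Tao2016AveragedNS`]
-/

noncomputable section

open Set MeasureTheory intervalIntegral Filter
open scoped _root_.Topology

namespace Literature.Analysis.FluidPDE

namespace TaoCascade

open Literature.Analysis.ODE

/-! ## Two more largeness facts -/

/-- `A (1+ε₀)^{-n₀/4} ≤ δ` for `n₀` large (`ε₀, δ > 0`). [folklore] -/
theorem eventually_mul_rpow_neg_quarter_le {ε₀ : ℝ} (hε₀ : 0 < ε₀) (A : ℝ) {δ : ℝ} (hδ : 0 < δ) :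
    ∀ᶠ n₀ : ℤ in atTop, A * (1 + ε₀) ^ (-(n₀ : ℝ) / 4) ≤ δ := by
  have h1 : (1 : ℝ) < 1 + ε₀ := by linarith
  have hlim : Tendsto (fun n₀ : ℤ => A * (1 + ε₀) ^ (-(n₀ : ℝ) / 4)) atTop (𝓝 (A * 0)) := by
    refine Tendsto.const_mul A ?_
    have hbot : Tendsto (fun n₀ : ℤ => -(n₀ : ℝ) / 4) atTop atBot := by
      have h2 : Tendsto (fun x : ℝ => -x / 4) atTop atBot := by
        have : (fun x : ℝ => -x / 4) = fun x => (-(1 / 4 : ℝ)) * x := by ext x; ring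
        rw [this]
        exact (tendsto_const_mul_atBot_of_neg (by norm_num)).2 tendsto_id
      exact h2.comp tendsto_intCast_atTop_atTop
    exact (tendsto_rpow_atBot_of_base_gt_one _ h1).comp hbot
  rw [mul_zero] at hlim
  exact hlim.eventually_le_const hδ

/-- `ε e^{A} ≤ 1` for `ε → 0⁺` (`A` fixed). [folklore] -/
theorem eventually_nhdsGT_mul_exp_le_one (A : ℝ) :
    ∀ᶠ ε in 𝓝[>] (0 : ℝ), ε * Real.exp A ≤ 1 := by
  have hpos : 0 < (Real.exp A)⁻¹ := by positivity
  have : Iio (Real.exp A)⁻¹ ∈ 𝓝[>] (0 : ℝ) := mem_nhdsWithin_of_mem_nhds (Iio_mem_nhds hpos)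
  refine Filter.mem_of_superset this fun ε (hε : ε < (Real.exp A)⁻¹) => ?_
  show ε * Real.exp A ≤ 1
  have hE : 0 < Real.exp A := Real.exp_pos A
  have h1 : ε * Real.exp A < (Real.exp A)⁻¹ * Real.exp A := mul_lt_mul_of_pos_right hε hE
  rw [inv_mul_cancel₀ hE.ne'] at h1
  exact h1.le

/-! ## `ReducedClaimIIInput` from a `Setting`-based Prop. 6.15 -/

/-- **The regime input `ReducedClaimIIInput` (Prop. 6.15) from a proof of Prop. 6.15 in the
`ZeroScale.Setting` packaging.** [cite: Tao2016AveragedNS, §6.6 Prop. 6.15; §6.7] -/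
theorem reducedClaimIIInput_of_setting
    (h615 : ∀ ⦃ε₀ K ε C₁ C₂ C₃ C₄ C₅ : ℝ⦄ ⦃n₀ N : ℤ⦄ ⦃τ : ℤ → ℝ⦄ ⦃Y : Fin 4 → ℤ → ℝ → ℝ⦄
      ⦃F : ℤ → ℝ → ℝ⦄ ⦃T : ℝ⦄, ZeroScale.Setting ε₀ K ε C₁ C₂ C₃ C₄ C₅ n₀ N τ Y F T →
        ZeroScale.ExitTrichotomy ε₀ K Y F T →
          ∃ τ₁ ∈ Icc (1 / 100 : ℝ) T, ZeroScale.NextState ε₀ K ε Y F τ₁) :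
    ReducedClaimIIInput := by
  -- the regime conditions, with `C₄ = 11`, `C₅ = C₂ (1+ε₀)² (cumEnergyConst ε₀ C₃ + 100)`
  have hK6 : InRegime (fun K => 1 / 10 ^ 5 * Real.exp (-K ^ 10 / 2)) fun D => (10 : ℝ) ^ 6 ≤ D.K :=
    InRegime.of_K (p := fun _ _ K => (10 : ℝ) ^ 6 ≤ K) fun _ _ _ _ _ => eventually_ge_atTop _
  have hKε₀ : InRegime (fun K => 1 / 10 ^ 5 * Real.exp (-K ^ 10 / 2)) fun D =>
      (10 : ℝ) ^ 6 ≤ D.K * D.ε₀ := by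
    refine InRegime.of_K (p := fun ε₀ _ K => (10 : ℝ) ^ 6 ≤ K * ε₀) fun ε₀ _ hε₀ _ _ => ?_
    exact (tendsto_id.atTop_mul_const hε₀).eventually_ge_atTop _
  have hε1 : InRegime (fun K => 1 / 10 ^ 5 * Real.exp (-K ^ 10 / 2)) fun D => D.ε ≤ 1 := by
    refine InRegime.of_eps (p := fun _ _ _ ε => ε ≤ 1) fun _ _ _ _ _ _ _ => ?_
    have : Iio (1 : ℝ) ∈ 𝓝[>] (0 : ℝ) := mem_nhdsWithin_of_mem_nhds (Iio_mem_nhds (by norm_num))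
    exact Filter.mem_of_superset this fun ε (hε : ε < 1) => (le_of_lt hε : ε ≤ 1)
  have hεexp : InRegime (fun K => 1 / 10 ^ 5 * Real.exp (-K ^ 10 / 2)) fun D =>
      D.ε * Real.exp (10 ^ 6 * D.K ^ 10) ≤ 1 :=
    InRegime.of_eps (p := fun _ _ K ε => ε * Real.exp (10 ^ 6 * K ^ 10) ≤ 1) fun _ _ K _ _ _ _ =>
      eventually_nhdsGT_mul_exp_le_one _
  have hlate : InRegime (fun K => 1 / 10 ^ 5 * Real.exp (-K ^ 10 / 2)) fun D =>
      (D.C₁ + D.C₂ + D.C₂ * (1 + D.ε₀) ^ (2 : ℝ) * (cumEnergyConst D.ε₀ D.C₃ + 100) + 1) *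
        (1 + D.ε₀) ^ (-(D.n₀ : ℝ) / 4) ≤ D.ε ^ 4 * Real.exp (-10 * D.K ^ 10) := by
    refine InRegime.of_n0 (p := fun ε₀ K ε C₁ C₂ C₃ n₀ =>
      (C₁ + C₂ + C₂ * (1 + ε₀) ^ (2 : ℝ) * (cumEnergyConst ε₀ C₃ + 100) + 1) *
        (1 + ε₀) ^ (-(n₀ : ℝ) / 4) ≤ ε ^ 4 * Real.exp (-10 * K ^ 10))
      fun ε₀ K ε C₁ C₂ C₃ hε₀ _ _ hε _ _ _ => ?_
    exact eventually_mul_rpow_neg_quarter_le hε₀ _ (by positivity)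
  have hK2 : InRegime (fun K => 1 / 10 ^ 5 * Real.exp (-K ^ 10 / 2)) fun D => 11 ≤ D.K :=
    InRegime.of_K (p := fun _ _ K => 11 ≤ K) fun _ _ _ _ _ => eventually_ge_atTop _
  unfold ReducedClaimIIInput
  refine (((((hK6.and hKε₀).and hε1).and hεexp).and hlate).and hK2).mono ?_
  rintro D hD ⟨⟨⟨⟨⟨hK6D, hKε₀D⟩, hε1D⟩, hεexpD⟩, hlateD⟩, hK2D⟩ T hT hgood hb13 hint hex
  have hK1 : 1 ≤ D.K := by linarith
  have hK2' : 2 ≤ D.K := by linarith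
  -- `SmallModes K ε 11` from the absorbed bounds of Prop. 6.13
  have hsmall : ZeroScale.SmallModes D.K D.ε 11 D.Y T := by
    refine ⟨fun t ht => (hb13 t ht).1, fun t ht => ((hb13 t ht).2.1).trans ?_⟩
    have hx : D.K ^ (-(1 : ℝ) / 4) ≤ 11 :=
      (Real.rpow_le_one_of_one_le_of_nonpos hK1 (by norm_num)).trans (by norm_num)
    have h0 : 0 ≤ Real.exp (-D.K ^ 10 / 2) * D.ε ^ 2 := by positivity
    calc D.K ^ (-(1 : ℝ) / 4) * Real.exp (-D.K ^ 10 / 2) * D.ε ^ 2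
        = D.K ^ (-(1 : ℝ) / 4) * (Real.exp (-D.K ^ 10 / 2) * D.ε ^ 2) := by ring
      _ ≤ 11 * (Real.exp (-D.K ^ 10 / 2) * D.ε ^ 2) := mul_le_mul_of_nonneg_right hx h0
      _ = 11 * Real.exp (-D.K ^ 10 / 2) * D.ε ^ 2 := by ring
  -- the context of §6.7 at `T`
  have hctx := hD.hyp.zeroScale_context hD.ε₀_pos hD.ε₀_lt_one hK2' hD.ε_pos hε1D hD.C₁_nonneg
    hD.C₂_nonneg hD.C₃_nonneg hD.n₀_le_N hT hgood (by norm_num : (0 : ℝ) ≤ 11) hsmall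
  -- the setting
  have hs : ZeroScale.Setting D.ε₀ D.K D.ε D.C₁ D.C₂ D.C₃ 11
      (D.C₂ * (1 + D.ε₀) ^ (2 : ℝ) * (cumEnergyConst D.ε₀ D.C₃ + 100)) D.n₀ D.N D.τ D.Y D.F T :=
    { toContext := hctx
      K_large := hK6D
      Kε₀ := hKε₀D
      C₄_le := hK2D
      ε_exp := hεexpD
      late := hlateD }
  exact h615 hs hex

/-- **The corrected Prop. 6.5 (`rescaledStepCorrected'`) from a `Setting`-based proof of Prop. 6.15
and the regime form of Prop. 6.13.** [cite: Tao2016AveragedNS, §6.6–6.7] -/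
theorem rescaledStepCorrected'_of_setting (h13 : SmallScaleOneInput)
    (h615 : ∀ ⦃ε₀ K ε C₁ C₂ C₃ C₄ C₅ : ℝ⦄ ⦃n₀ N : ℤ⦄ ⦃τ : ℤ → ℝ⦄ ⦃Y : Fin 4 → ℤ → ℝ → ℝ⦄
      ⦃F : ℤ → ℝ → ℝ⦄ ⦃T : ℝ⦄, ZeroScale.Setting ε₀ K ε C₁ C₂ C₃ C₄ C₅ n₀ N τ Y F T →
        ZeroScale.ExitTrichotomy ε₀ K Y F T →
          ∃ τ₁ ∈ Icc (1 / 100 : ℝ) T, ZeroScale.NextState ε₀ K ε Y F τ₁) :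
    rescaledStepCorrected' :=
  rescaledStepCorrected'_of_inputs h13 (reducedClaimIIInput_of_setting h615)

end TaoCascade

end Literature.Analysis.FluidPDE
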